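import Summits.Schanuel.Schanuel.Theorems.RootDecomp1AdditiveCellsD

/-!
# RootDecomp1 — ROUND 15 «AdditiveCells», part 3: certified literal members

Continuation of `RootDecomp1AdditiveCells` / `RootDecomp1AdditiveCellsD` (lens 1, gen 15).

* THE CYCLOTOMIC QUARTIC LINE `μ·(1, ζ₅, ζ₅², ζ₅³)`, ANY base `μ ≠ 0` (`cycloLine`): ℚ-free, `trdeg ℚ(z) ≤ 1`,
  VALUE degree `≥ 2` (Theorem 2.9 `(3,3)`), and **item B at `n = 4` HOLDS there on the disjoint stratum**
  (`cycloLine_member`; `member_pi_cycloLine`: base `π`, `trdeg ℚ(z) = 1`, `e^{πζ₅^k} ∉ ℚ̄`-questions untouched —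
  the critic's family «𝕃-free, `trdeg ℚ(z) = 1`»; `member_e_cycloLine`: base `e`).
* THE LW-CONS TRIPLE `(π | 1, √2)` (`piConsTriple`): ℚ-free, two ℚ-free algebraic numbers in the span, so **item D
  at `n = 3` HOLDS there on the disjoint stratum** (`member_piConsTriple`) — a D₃-cell member OUTSIDE round 14's
  E-stable stratum and outside the round-6 `logCons` cell (head `π ∉ 𝓛`).
* THE POWER TRIPLE `(π, π², π³)` (`member_powerTriple_pi`): ℚ-free, PLAIN, `trdeg ℚ(z) = 1`; D₃ there ⟺
  `2 ≤ trdeg ℚ(e^π, e^{π²}, e^{π³})` — OPEN (Nesterenko gives only `e^π ∉ ℚ̄` jointly with `π`).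

Port: `Summits/Schanuel/Schanuel/Theorems/RootDecomp1AdditiveCellsMembers.lean`; evidence on stmt-Schanuel-25020
(B₄ members) and stmt-Schanuel-30353 (D₃ members / open power-line member).  0 sorry; `h29` = the tree theorem
`smallTrdeg_thm_2_9_pos_holds`.
-/

set_option linter.dupNamespace false

noncomputable section

namespace Summit.Schanuel.Schanuel.Theorems.RootDecomp1AdditiveCellsMembers

open Complex IntermediateField Module Polynomial
open Literature.NumberTheory.Transcendental (transcendental_pi_holds)
open Literature.Barriers.Schanuel (smallTrdeg_thm_2_9_pos smallTrdeg_thm_2_9_two_two)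
open Summit.Schanuel.Schanuel.Theorems.RootDecomp1EAnchor (isAlgebraic_of_mem_adjoin isAlgebraic_mul)
open Summit.Schanuel.Schanuel.Theorems.RootDecomp1EEStableRung (one_le_trdeg_adjoin_of_transcendental)
open Summit.Schanuel.Schanuel.Theorems.RootDecomp1ArgumentCells (trdeg_args_le_one_of_isAlgebraic_adjoin_singleton)
open Summit.Schanuel.Schanuel.Theorems.RootDecomp1AdditiveCells (linearIndependent_pow_castLE
  linearIndependent_mul_left two_le_valDegree_of_numberFieldLine defectOne_of_valueTwo_split)
open Summit.Schanuel.Schanuel.Theorems.RootDecomp1AdditiveCellsD (powerTriple powerTriple_linearIndependent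
  powerTriple_plain argDegree_powerTriple_le_one one_le_argDegree_powerTriple disjointSchanuel_powerTriple_iff
  disjointSchanuel_of_lwSpan one_le_valDegree_powerTriple)

/-- (print-twin of `RootDecomp1AdditiveCellsD.ne_zero_of_transcendental`, private there) A transcendental number is non-zero. -/
private theorem ne_zero_of_transcendental {w : ℂ} (hw : Transcendental ℚ w) : w ≠ 0 := by
  rintro rfl
  exact hw isAlgebraic_zero

/-- `π` is transcendental as a complex number (tree theorem `transcendental_pi_holds`, transported along `ℝ → ℂ`). -/
private theorem transcendental_pi_complex : Transcendental ℚ (Real.pi : ℂ) :=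
  (transcendental_algebraMap_iff (R := ℚ) (A := ℂ) Complex.ofReal_injective).mpr transcendental_pi_holds

/-! ## §7a  The cyclotomic quartic line `μ·(1, ζ₅, ζ₅², ζ₅³)` — a B₄ member family, any base -/

/-- `ζ₅ = e^{2πi/5}`. -/
def zeta5 : ℂ := cexp (2 * Real.pi * I / (5 : ℕ))

/-- `IsPrimitiveRoot zeta5 5`. -/
private theorem zeta5_isPrimitiveRoot : IsPrimitiveRoot zeta5 5 := Complex.isPrimitiveRoot_exp 5 (by norm_num)

/-- `zeta5 ^ 5 = 1`. -/
private theorem zeta5_pow_five : zeta5 ^ 5 = 1 := zeta5_isPrimitiveRoot.pow_eq_one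

/-- `IsAlgebraic ℚ zeta5`. -/
private theorem zeta5_isAlgebraic : IsAlgebraic ℚ zeta5 :=
  IsAlgebraic.of_pow (by norm_num : 0 < 5) (by rw [zeta5_pow_five]; exact isAlgebraic_one)

/-- `[ℚ(ζ₅) : ℚ] = 4`. -/
theorem minpoly_zeta5_natDegree : (minpoly ℚ zeta5).natDegree = 4 := by
  rw [← cyclotomic_eq_minpoly_rat zeta5_isPrimitiveRoot (by norm_num : 0 < 5), natDegree_cyclotomic,
    Nat.totient_prime (by norm_num : Nat.Prime 5)]

/-- The cyclotomic relation `ζ₅⁴ = −1 − ζ₅ − ζ₅² − ζ₅³`. -/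
theorem zeta5_pow_four : zeta5 ^ 4 = -1 - zeta5 - zeta5 ^ 2 - zeta5 ^ 3 := by
  have h := zeta5_isPrimitiveRoot.geom_sum_eq_zero (by norm_num : 1 < 5)
  simp only [Finset.sum_range_succ, Finset.sum_range_zero, pow_zero, zero_add, pow_one] at h
  linear_combination h

/-- The cyclotomic quartic line with base `μ`: `(μ, μζ₅, μζ₅², μζ₅³)`. -/
def cycloLine (μ : ℂ) : Fin 4 → ℂ := fun i => μ * zeta5 ^ (i : ℕ)

/-- `LinearIndependent ℚ (cycloLine μ)`. -/
theorem cycloLine_linearIndependent {μ : ℂ} (hμ : μ ≠ 0) : LinearIndependent ℚ (cycloLine μ) :=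
  linearIndependent_mul_left (linearIndependent_pow_castLE (β := zeta5) minpoly_zeta5_natDegree.ge) hμ

/-- `span_ℚ (cycloLine μ) = μ·ℚ(ζ₅)` contains every `μζ₅^k`. -/
theorem mul_zeta5_pow_mem_span (μ : ℂ) (k : ℕ) :
    μ * zeta5 ^ k ∈ Submodule.span ℚ (Set.range (cycloLine μ)) := by
  have g : ∀ j : ℕ, j < 4 → μ * zeta5 ^ j ∈ Submodule.span ℚ (Set.range (cycloLine μ)) :=
    fun j hj => Submodule.subset_span ⟨⟨j, hj⟩, rfl⟩
  rw [← Nat.mod_add_div k 5, pow_add, pow_mul, zeta5_pow_five, one_pow, mul_one]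
  obtain ⟨r, hr, hrk⟩ : ∃ r, r < 5 ∧ k % 5 = r := ⟨_, Nat.mod_lt _ (by norm_num), rfl⟩
  rw [hrk]
  interval_cases r
  · exact g 0 (by norm_num)
  · exact g 1 (by norm_num)
  · exact g 2 (by norm_num)
  · exact g 3 (by norm_num)
  · have e : μ * zeta5 ^ 4 = -(μ * zeta5 ^ 0) - μ * zeta5 ^ 1 - μ * zeta5 ^ 2 - μ * zeta5 ^ 3 := by
      rw [zeta5_pow_four]; ring
    rw [e]
    exact sub_mem (sub_mem (sub_mem (neg_mem (g 0 (by norm_num))) (g 1 (by norm_num))) (g 2 (by norm_num)))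
      (g 3 (by norm_num))

/-- `trdeg ℚ(cycloLine μ) ≤ 1`: every entry is algebraic over `ℚ(μ)`. -/
theorem argDegree_cycloLine_le_one (μ : ℂ) :
    Algebra.trdeg ℚ ↥(adjoin ℚ (Set.range (cycloLine μ))) ≤ 1 := by
  refine trdeg_args_le_one_of_isAlgebraic_adjoin_singleton (cycloLine μ) μ fun i => ?_
  exact isAlgebraic_mul (isAlgebraic_of_mem_adjoin (mem_adjoin_simple_self ℚ μ))
    ((zeta5_isAlgebraic.pow _).tower_top (L := ↥(adjoin ℚ ({μ} : Set ℂ))))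

/-- **MEMBER FAMILY `μ·(1, ζ₅, ζ₅², ζ₅³)`, ANY `μ ≠ 0`:** ℚ-free · `trdeg ℚ(z) ≤ 1` · `2 ≤ trdeg ℚ(e^z)` (Theorem 2.9
`(3,3)` on `x = (1, ζ₅, ζ₅²)`, `y = μx`) · **item B at `n = 4` HOLDS under the split `ε = 0`** (`1 + 2 + 1 = 4`, or
LW if `μ ∈ ℚ̄`).  For `μ ∉ ℚ̄` the bidegree row is `trdeg ℚ(z) = 1` (next theorem). -/
theorem cycloLine_member (h29 : smallTrdeg_thm_2_9_pos) {μ : ℂ} (hμ : μ ≠ 0) :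
    LinearIndependent ℚ (cycloLine μ) ∧
    Algebra.trdeg ℚ ↥(adjoin ℚ (Set.range (cycloLine μ))) ≤ 1 ∧
    (2 : Cardinal) ≤ Algebra.trdeg ℚ ↥(adjoin ℚ (Set.range (cexp ∘ cycloLine μ))) ∧
    (Algebra.trdeg ℚ ↥(adjoin ℚ (Set.range (cycloLine μ))) +
        Algebra.trdeg ℚ ↥(adjoin ℚ (Set.range (cexp ∘ cycloLine μ))) ≤
        Algebra.trdeg ℚ ↥(adjoin ℚ (Set.range (cycloLine μ) ∪ Set.range (cexp ∘ cycloLine μ))) →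
      ((4 : ℕ) : Cardinal) ≤
        Algebra.trdeg ℚ ↥(adjoin ℚ (Set.range (cycloLine μ) ∪ Set.range (cexp ∘ cycloLine μ))) + 1) := by
  have hv : (2 : Cardinal) ≤ Algebra.trdeg ℚ ↥(adjoin ℚ (Set.range (cexp ∘ cycloLine μ))) :=
    two_le_valDegree_of_numberFieldLine h29 (cycloLine μ) zeta5_isAlgebraic
      (by rw [minpoly_zeta5_natDegree]; norm_num) hμ (mul_zeta5_pow_mem_span μ)
  exact ⟨cycloLine_linearIndependent hμ, argDegree_cycloLine_le_one μ, hv,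
    fun hsplit => defectOne_of_valueTwo_split le_rfl (cycloLine μ) (cycloLine_linearIndependent hμ) hv hsplit⟩

/-- For a TRANSCENDENTAL base the argument degree is exactly `1`. -/
theorem one_le_argDegree_cycloLine {μ : ℂ} (hμ : Transcendental ℚ μ) :
    (1 : Cardinal) ≤ Algebra.trdeg ℚ ↥(adjoin ℚ (Set.range (cycloLine μ))) :=
  one_le_trdeg_adjoin_of_transcendental hμ ⟨0, by simp [cycloLine]⟩

/-- **MEMBER `π·(1, ζ₅, ζ₅², ζ₅³)`**: ℚ-free, `trdeg ℚ(z) = 1`, `2 ≤ trdeg ℚ(e^{πζ₅^k} : k < 4)`, and **B₄ HOLDS there on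
the disjoint stratum**; Schanuel there asks `trdeg ℚ(π, e^π, e^{πζ₅}, e^{πζ₅²}, e^{πζ₅³}) ≥ 4` — OPEN.  (Not formalised:
every `e^{πζ₅^k} = (−1)^{−iζ₅^k}` is transcendental by Gel'fond–Schneider and `span_ℚ z ∩ 𝓛 = 0` since
`ℚ(ζ₅) ∩ iℚ = 0` — the line is `𝕃`-free with `trdeg ℚ(z) = 1`, the critic's example family (ix)(ii).) -/
theorem member_pi_cycloLine (h29 : smallTrdeg_thm_2_9_pos) :
    LinearIndependent ℚ (cycloLine (Real.pi : ℂ)) ∧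
    Algebra.trdeg ℚ ↥(adjoin ℚ (Set.range (cycloLine (Real.pi : ℂ)))) ≤ 1 ∧
    (1 : Cardinal) ≤ Algebra.trdeg ℚ ↥(adjoin ℚ (Set.range (cycloLine (Real.pi : ℂ)))) ∧
    (2 : Cardinal) ≤ Algebra.trdeg ℚ ↥(adjoin ℚ (Set.range (cexp ∘ cycloLine (Real.pi : ℂ)))) ∧
    (Algebra.trdeg ℚ ↥(adjoin ℚ (Set.range (cycloLine (Real.pi : ℂ)))) +
        Algebra.trdeg ℚ ↥(adjoin ℚ (Set.range (cexp ∘ cycloLine (Real.pi : ℂ)))) ≤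
        Algebra.trdeg ℚ ↥(adjoin ℚ (Set.range (cycloLine (Real.pi : ℂ)) ∪
          Set.range (cexp ∘ cycloLine (Real.pi : ℂ)))) →
      ((4 : ℕ) : Cardinal) ≤
        Algebra.trdeg ℚ ↥(adjoin ℚ (Set.range (cycloLine (Real.pi : ℂ)) ∪
          Set.range (cexp ∘ cycloLine (Real.pi : ℂ)))) + 1) := by
  obtain ⟨h1, h2, h3, h4⟩ := cycloLine_member h29 (Complex.ofReal_ne_zero.mpr Real.pi_ne_zero)
  exact ⟨h1, h2, one_le_argDegree_cycloLine transcendental_pi_complex, h3, h4⟩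

/-- **MEMBER `e·(1, ζ₅, ζ₅², ζ₅³)`** (base `e`; nature of `e^e` unknown): ℚ-free, `trdeg ℚ(z) ≤ 1`,
`2 ≤ trdeg ℚ(e^z)`, B₄ HOLDS there on the disjoint stratum. -/
theorem member_e_cycloLine (h29 : smallTrdeg_thm_2_9_pos) :
    LinearIndependent ℚ (cycloLine (cexp 1)) ∧
    Algebra.trdeg ℚ ↥(adjoin ℚ (Set.range (cycloLine (cexp 1)))) ≤ 1 ∧
    (2 : Cardinal) ≤ Algebra.trdeg ℚ ↥(adjoin ℚ (Set.range (cexp ∘ cycloLine (cexp 1)))) ∧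
    (Algebra.trdeg ℚ ↥(adjoin ℚ (Set.range (cycloLine (cexp 1)))) +
        Algebra.trdeg ℚ ↥(adjoin ℚ (Set.range (cexp ∘ cycloLine (cexp 1)))) ≤
        Algebra.trdeg ℚ ↥(adjoin ℚ (Set.range (cycloLine (cexp 1)) ∪ Set.range (cexp ∘ cycloLine (cexp 1)))) →
      ((4 : ℕ) : Cardinal) ≤
        Algebra.trdeg ℚ ↥(adjoin ℚ (Set.range (cycloLine (cexp 1)) ∪ Set.range (cexp ∘ cycloLine (cexp 1)))) + 1) :=
  cycloLine_member h29 (Complex.exp_ne_zero 1)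

/-! ## §7b  The LW-cons triple `(π | 1, √2)` — a D₃ member outside the E-stable stratum -/

/-- `(π, 1, √2)`. -/
def piConsTriple : Fin 3 → ℂ := ![(Real.pi : ℂ), 1, (Real.sqrt 2 : ℂ)]

/-- `(1, √2)` is ℚ-free. -/
theorem one_sqrt_two_linearIndependent : LinearIndependent ℚ ![(1 : ℂ), (Real.sqrt 2 : ℂ)] := by
  rw [LinearIndependent.pair_iff]
  intro s t hst
  have h : (s : ℂ) + (t : ℂ) * (Real.sqrt 2 : ℂ) = 0 := by simpa [Rat.smul_def] using hst
  have hR : (s : ℝ) + (t : ℝ) * Real.sqrt 2 = 0 := by exact_mod_cast h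
  by_cases ht : t = 0
  · subst ht
    have hs : (s : ℝ) = 0 := by simpa using hR
    exact ⟨by exact_mod_cast hs, rfl⟩
  · exfalso
    have htR : (t : ℝ) ≠ 0 := by exact_mod_cast ht
    refine irrational_sqrt_two ⟨-s / t, ?_⟩
    rw [Rat.cast_div, Rat.cast_neg, eq_comm, eq_div_iff htR]
    linear_combination hR

/-- `LinearIndependent ℚ piConsTriple`. -/
theorem piConsTriple_linearIndependent : LinearIndependent ℚ piConsTriple := by
  rw [Fintype.linearIndependent_iff]
  intro g hg
  have hsum : (g 0 : ℂ) * (Real.pi : ℂ) + (g 1 : ℂ) + (g 2 : ℂ) * (Real.sqrt 2 : ℂ) = 0 := by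
    simpa [Fin.sum_univ_three, piConsTriple, Rat.smul_def] using hg
  -- the head coefficient vanishes: otherwise `π` would be algebraic
  have h0 : g 0 = 0 := by
    by_contra h0
    have h0C : (g 0 : ℂ) ≠ 0 := by exact_mod_cast h0
    have hπ : (Real.pi : ℂ) = -((g 1 : ℂ) + (g 2 : ℂ) * (Real.sqrt 2 : ℂ)) / (g 0 : ℂ) := by
      rw [eq_div_iff h0C]; linear_combination hsum
    apply transcendental_pi_complex
    rw [hπ]
    refine IsAlgebraic.mul (IsAlgebraic.neg (IsAlgebraic.add (isAlgebraic_algebraMap (g 1)) ?_)) ?_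
    · refine IsAlgebraic.mul (isAlgebraic_algebraMap (g 2)) ?_
      refine IsAlgebraic.of_pow (by norm_num : 0 < 2) ?_
      have : (Real.sqrt 2 : ℂ) ^ 2 = 2 := by
        rw [← Complex.ofReal_pow, Real.sq_sqrt (by norm_num : (0 : ℝ) ≤ 2)]; norm_num
      rw [this]
      exact isAlgebraic_nat 2
    · exact IsAlgebraic.inv (isAlgebraic_algebraMap (g 0))
  have hrest : (g 1 : ℚ) • (1 : ℂ) + (g 2 : ℚ) • (Real.sqrt 2 : ℂ) = 0 := by
    rw [Rat.smul_def, Rat.smul_def]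
    have : (g 0 : ℂ) = 0 := by exact_mod_cast h0
    linear_combination hsum - (Real.pi : ℂ) * this
  obtain ⟨h1, h2⟩ := LinearIndependent.pair_iff.mp one_sqrt_two_linearIndependent _ _ hrest
  intro i
  fin_cases i
  · exact h0
  · exact h1
  · exact h2

/-- **MEMBER `(π | 1, √2)`**: ℚ-free; `span_ℚ z` contains the ℚ-free algebraic pair `(1, √2)`; so **item D at
`n = 3` HOLDS there on the disjoint stratum**: `3 ≤ trdeg ℚ(π, 1, √2, e^π, e, e^{√2})` under the split
(`a = 1` from `π`, `v = 2` by Lindemann–Weierstrass).  Head `π ∉ 𝓛`, span PLAIN: outside the `logCons` cell and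
outside the E-stable stratum. -/
theorem member_piConsTriple
    (hsplit : Algebra.trdeg ℚ ↥(adjoin ℚ (Set.range piConsTriple)) +
        Algebra.trdeg ℚ ↥(adjoin ℚ (Set.range (cexp ∘ piConsTriple))) ≤
      Algebra.trdeg ℚ ↥(adjoin ℚ (Set.range piConsTriple ∪ Set.range (cexp ∘ piConsTriple)))) :
    ((3 : ℕ) : Cardinal) ≤ Algebra.trdeg ℚ ↥(adjoin ℚ (Set.range piConsTriple ∪ Set.range (cexp ∘ piConsTriple))) := by
  refine disjointSchanuel_of_lwSpan piConsTriple piConsTriple_linearIndependent ![(1 : ℂ), (Real.sqrt 2 : ℂ)]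
    one_sqrt_two_linearIndependent ?_ ?_ (by norm_num) hsplit
  · intro j
    fin_cases j
    · simpa using isAlgebraic_one
    · refine IsAlgebraic.of_pow (by norm_num : 0 < 2) ?_
      have : (Real.sqrt 2 : ℂ) ^ 2 = 2 := by
        rw [← Complex.ofReal_pow, Real.sq_sqrt (by norm_num : (0 : ℝ) ≤ 2)]; norm_num
      simpa [this] using isAlgebraic_nat (R := ℚ) (A := ℂ) 2
  · intro j
    fin_cases j
    · simpa [piConsTriple] using
        (Submodule.subset_span ⟨1, rfl⟩ : piConsTriple 1 ∈ Submodule.span ℚ (Set.range piConsTriple))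
    · simpa [piConsTriple] using
        (Submodule.subset_span ⟨2, rfl⟩ : piConsTriple 2 ∈ Submodule.span ℚ (Set.range piConsTriple))

/-! ## §7c  The power triple `(π, π², π³)` — the first OPEN D₃ member outside the stratum -/

/-- **MEMBER `(π, π², π³)`**: ℚ-free · PLAIN (no irrational multiplier — outside the E-stable stratum) · `trdeg ℚ(z) = 1` ·
under the split, D₃ there ⟺ `2 ≤ trdeg ℚ(e^π, e^{π²}, e^{π³})` — OPEN: no instrument certifies two algebraically
independent values on a plain 3-dimensional span (instrument card, `NODE-g15.md` §3). -/
theorem member_powerTriple_pi :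
    LinearIndependent ℚ (powerTriple (Real.pi : ℂ)) ∧
    (∀ β : ℂ, (∀ i, β * powerTriple (Real.pi : ℂ) i ∈ Submodule.span ℚ (Set.range (powerTriple (Real.pi : ℂ)))) →
      β ∈ Set.range (algebraMap ℚ ℂ)) ∧
    Algebra.trdeg ℚ ↥(adjoin ℚ (Set.range (powerTriple (Real.pi : ℂ)))) ≤ 1 ∧
    (1 : Cardinal) ≤ Algebra.trdeg ℚ ↥(adjoin ℚ (Set.range (powerTriple (Real.pi : ℂ)))) ∧
    ((Algebra.trdeg ℚ ↥(adjoin ℚ (Set.range (powerTriple (Real.pi : ℂ)))) +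
          Algebra.trdeg ℚ ↥(adjoin ℚ (Set.range (cexp ∘ powerTriple (Real.pi : ℂ)))) ≤
        Algebra.trdeg ℚ ↥(adjoin ℚ (Set.range (powerTriple (Real.pi : ℂ)) ∪
          Set.range (cexp ∘ powerTriple (Real.pi : ℂ))))) →
      (((3 : ℕ) : Cardinal) ≤ Algebra.trdeg ℚ ↥(adjoin ℚ (Set.range (powerTriple (Real.pi : ℂ)) ∪
            Set.range (cexp ∘ powerTriple (Real.pi : ℂ)))) ↔
        (2 : Cardinal) ≤ Algebra.trdeg ℚ ↥(adjoin ℚ (Set.range (cexp ∘ powerTriple (Real.pi : ℂ)))))) :=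
  ⟨powerTriple_linearIndependent transcendental_pi_complex,
    fun _ hβ => powerTriple_plain transcendental_pi_complex hβ,
    argDegree_powerTriple_le_one _, one_le_argDegree_powerTriple transcendental_pi_complex,
    fun hsplit => disjointSchanuel_powerTriple_iff transcendental_pi_complex hsplit⟩

/-- **… and its certified value floor**: `1 ≤ trdeg ℚ(e^π, e^{π²}, e^{π³})` (uniformly in the base, by the «Moreover»
clause of Theorem 2.9 = Brownawell–Waldschmidt, tree theorem `smallTrdeg_thm_2_9_two_two_holds`); D₃ there needs `2`. -/
theorem member_powerTriple_pi_valueOne (h22 : smallTrdeg_thm_2_9_two_two) :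
    (1 : Cardinal) ≤ Algebra.trdeg ℚ ↥(adjoin ℚ (Set.range (cexp ∘ powerTriple (Real.pi : ℂ)))) :=
  one_le_valDegree_powerTriple h22 transcendental_pi_complex

end Summit.Schanuel.Schanuel.Theorems.RootDecomp1AdditiveCellsMembers

end
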